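import Literature.Analysis.FluidPDE.AxisymQuotientEquations
import HarnessLib

/-!
# Pointwise bounds for the Hou–Li quotients: `|u^θ/r|, |uʳ/r| ≤ |Du|`, `|ω^θ/r|, |ωʳ/r| ≤ |Dω|`,
# `J = −∂_z(u^θ/r)`, and `∂_z` commutes with the quotients

Analysis/FluidPDE support file (calculus only; theorems, no definitions, no named facts) on the
discharge path of the named facts `Literature.Analysis.FluidPDE.LeiZhang2017_logModulus_regularity`,
`…LeiZhang2017_smallSwirl_regularity`, `…Wei2016_logModulus_regularity`. Lei–Zhang 2017
(arXiv:1505.02628), §3, p. 8: "`∇ωʳ, ∇ω^θ, ∇ωᶻ, ωʳ/r, ω^θ/r` are all `L²`-functions … `J(t,·) ∈ L²,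
Ω(t,·) ∈ L²`", and §1: `J = −∂_z(v^θ/r) = ωʳ/r` (below (1.4)).

The mechanism is the **infinitesimal axisymmetry** `Du(x)[Jx] = J u(x)` (`J = rotGen`, the
generator of the rotations; `IsAxisymmetric.fderiv_rotGen`): since `|Jx| = r` and
`|J u(x)| = |u_h(x)|`, the horizontal part of an axisymmetric `C¹` field obeys
`|u_h(x)| ≤ r ‖Du(x)‖` **at the same point**, whence

* `IsAxisymmetric.abs_swirl_le_mul_norm_fderiv`, `…abs_horizontal_inner_le_mul_norm_fderiv` —
  `|x₀u₁ − x₁u₀|, |x₀u₀ + x₁u₁| ≤ r² ‖Du(x)‖`;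
* `IsAxisymmetric.abs_angVelQuot_le_norm_fderiv`, `…abs_radVelQuot_le_norm_fderiv` —
  `|u^θ/r|(x), |uʳ/r|(x) ≤ ‖Du(x)‖` everywhere (off the axis by the above, across it by density,
  `le_of_le_off_ker`), and `…abs_angVortQuot_le_norm_fderiv_curl`,
  `…abs_radVelQuot_curl_le_norm_fderiv_curl` — `|ω^θ/r|, |ωʳ/r| ≤ ‖Dω(x)‖`;
* `IsAxisymmetric.fderiv_apply_single_two` — `∂_z u` is axisymmetric;
  `IsAxisymmetric.fderiv_angVelQuot_single_two` — `∂_z (u^θ/r) = (∂_z u)^θ/r`;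
* `IsAxisymmetric.radVelQuot_curl_eq_neg_fderiv_angVelQuot` — **`J = ωʳ/r = −∂_z(u^θ/r)`**
  everywhere (`x₀ω₀ + x₁ω₁ = −∂_zΓ + (Du[Jx])₂`, and `(Du[Jx])₂ = (J u)₂ = 0`);
* `MemLp` corollaries: the quotients are in `L²` as soon as `Du` (resp. `Dω`) is
  (`memLp_angVelQuot_of_memLp_fderiv`, …).

## Mathlib / tree search

Tree: `IsAxisymmetric.fderiv_rotGen`, `rotGen_eq_sub_single`, `swirl_eq_inner_rotGen`,
`fderiv_swirl_apply`, `rotGen_single_two` (`SwirlTransportProofs`), `norm_rotGen`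
(`AxisymVorticityAlgebra`), `IsAxisymmetric.fderiv_rotZ`, `IsAxisymmetric.curl`
(`AxisymmetricVorticityTransport`), `rotZ_apply_single_two`, `IsAxisymmetric.cylRadius_sq_mul_*`
(`AxisymHouLiVariables`), `eq_of_eq_off_ker` (`AxisymmetricLiftR5`), `fderiv_rho_apply`
(`AxisymQuotientEquations`). `HouLeiLiSupBound`'s `IsAxisymmetric.abs_radVelQuot_le` is the Agmon
sup bound (different statement). Mathlib: `MemLp.of_le`, `le_of_tendsto_of_tendsto`.

## References

* Z. Lei, Q. S. Zhang, Pacific J. Math. 289 (2017) 169–187, arXiv:1505.02628, §1 (below (1.4)),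
  §3 p. 8. [`LeiZhang2017`]
* J.-G. Liu, W.-C. Wang, SIAM J. Math. Anal. 41 (2009), §2 (regularity of `u^θ/r`). [folklore]
-/

noncomputable section

open MeasureTheory Set Function Filter Topology InnerProductSpace WithLp
open scoped RealInnerProductSpace ContDiff ENNReal Topology

namespace Literature.Analysis.FluidPDE

/-! ### Inequalities off a hyperplane extend by density -/

section Density

variable {E E' : Type*} [NormedAddCommGroup E] [NormedSpace ℝ E] [NormedAddCommGroup E']
  [NormedSpace ℝ E']

/-- **Density of the complement of a proper kernel, inequality form**: if `P v ≠ 0` for some `v`,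
an inequality between continuous real functions valid off the kernel of `P` holds everywhere
(companion of `eq_of_eq_off_ker`). [folklore] -/
theorem le_of_le_off_ker (P : E →L[ℝ] E') (hP : ∃ v, P v ≠ 0) {g₁ g₂ : E → ℝ}
    (h₁ : Continuous g₁) (h₂ : Continuous g₂) (h : ∀ z, P z ≠ 0 → g₁ z ≤ g₂ z) (y : E) :
    g₁ y ≤ g₂ y := by
  by_cases hy : P y = 0
  swap
  · exact h y hy
  obtain ⟨v, hv⟩ := hP
  have htend : Tendsto (fun t : ℝ => y + t • v) (𝓝[≠] 0) (𝓝 y) := by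
    have hc : Continuous fun t : ℝ => y + t • v := by fun_prop
    have := hc.tendsto 0
    rw [zero_smul, add_zero] at this
    exact this.mono_left nhdsWithin_le_nhds
  have hev : ∀ᶠ t : ℝ in 𝓝[≠] 0, g₁ (y + t • v) ≤ g₂ (y + t • v) := by
    filter_upwards [self_mem_nhdsWithin] with t (ht : t ≠ 0)
    refine h _ ?_
    rw [map_add, hy, zero_add, map_smul]
    exact smul_ne_zero ht hv
  exact le_of_tendsto_of_tendsto ((h₁.tendsto y).comp htend) ((h₂.tendsto y).comp htend) hev

/-- An inequality between continuous real functions on `ℝ³` valid off the axis holds everywhere.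
[folklore] -/
theorem le_of_le_off_axis {g₁ g₂ : EuclideanSpace ℝ (Fin 3) → ℝ} (h₁ : Continuous g₁)
    (h₂ : Continuous g₂) (h : ∀ z, cylRadius z ≠ 0 → g₁ z ≤ g₂ z) (y : EuclideanSpace ℝ (Fin 3)) :
    g₁ y ≤ g₂ y := by
  refine le_of_le_off_ker (EuclideanSpace.proj (0 : Fin 3)) ⟨EuclideanSpace.single 0 1, by simp⟩
    h₁ h₂ (fun z hz => h z ?_) y
  have hz0 : z 0 ≠ 0 := by simpa using hz
  exact fun h0 => hz0 ((cylRadius_eq_zero_iff z).1 h0).1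

/-- An identity between continuous functions on `ℝ³` valid off the axis holds everywhere.
[folklore] -/
theorem eq_of_eq_off_axis {X : Type*} [TopologicalSpace X] [T2Space X]
    {g₁ g₂ : EuclideanSpace ℝ (Fin 3) → X} (h₁ : Continuous g₁) (h₂ : Continuous g₂)
    (h : ∀ z, cylRadius z ≠ 0 → g₁ z = g₂ z) (y : EuclideanSpace ℝ (Fin 3)) : g₁ y = g₂ y := by
  refine eq_of_eq_off_ker (EuclideanSpace.proj (0 : Fin 3)) ⟨EuclideanSpace.single 0 1, by simp⟩
    h₁ h₂ (fun z hz => h z ?_) y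
  have hz0 : z 0 ≠ 0 := by simpa using hz
  exact fun h0 => hz0 ((cylRadius_eq_zero_iff z).1 h0).1

end Density

/-! ### Pointwise bounds from the infinitesimal axisymmetry -/

section Pointwise

variable {u : EuclideanSpace ℝ (Fin 3) → EuclideanSpace ℝ (Fin 3)} {x : EuclideanSpace ℝ (Fin 3)}

/-- **`|u_h(x)| ≤ r ‖Du(x)‖`** for an axisymmetric field differentiable at `x`:
`√(u₀² + u₁²) = |J u(x)| = |Du(x)[Jx]| ≤ ‖Du(x)‖ |Jx| = r ‖Du(x)‖`. [folklore] -/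
theorem IsAxisymmetric.sqrt_sq_add_sq_le_mul_norm_fderiv (hax : IsAxisymmetric u)
    (hd : DifferentiableAt ℝ u x) :
    Real.sqrt (u x 0 ^ 2 + u x 1 ^ 2) ≤ cylRadius x * ‖fderiv ℝ u x‖ := by
  rw [← norm_rotGen (u x), ← hax.fderiv_rotGen hd]
  calc ‖fderiv ℝ u x (rotGen x)‖ ≤ ‖fderiv ℝ u x‖ * ‖rotGen x‖ := (fderiv ℝ u x).le_opNorm _
    _ = cylRadius x * ‖fderiv ℝ u x‖ := by rw [norm_rotGen, mul_comm]; rfl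

/-- **`|Γ(x)| = |x₀u₁ − x₁u₀| ≤ r² ‖Du(x)‖`** for an axisymmetric field. [folklore] -/
theorem IsAxisymmetric.abs_swirl_le_mul_norm_fderiv (hax : IsAxisymmetric u)
    (hd : DifferentiableAt ℝ u x) : |swirl u x| ≤ cylRadius x ^ 2 * ‖fderiv ℝ u x‖ := by
  have h1 : (swirl u x) ^ 2 ≤ cylRadius x ^ 2 * (u x 0 ^ 2 + u x 1 ^ 2) := by
    rw [cylRadius_sq, swirl]
    nlinarith [sq_nonneg (x 0 * u x 0 + x 1 * u x 1)]
  have h2 : |swirl u x| ≤ cylRadius x * Real.sqrt (u x 0 ^ 2 + u x 1 ^ 2) := by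
    have := Real.abs_le_sqrt h1
    rwa [Real.sqrt_mul (sq_nonneg _), Real.sqrt_sq (cylRadius_nonneg x)] at this
  calc |swirl u x| ≤ cylRadius x * Real.sqrt (u x 0 ^ 2 + u x 1 ^ 2) := h2
    _ ≤ cylRadius x * (cylRadius x * ‖fderiv ℝ u x‖) :=
        mul_le_mul_of_nonneg_left (hax.sqrt_sq_add_sq_le_mul_norm_fderiv hd) (cylRadius_nonneg x)
    _ = cylRadius x ^ 2 * ‖fderiv ℝ u x‖ := by ring

/-- **`|x₀u₀ + x₁u₁| ≤ r² ‖Du(x)‖`** for an axisymmetric field. [folklore] -/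
theorem IsAxisymmetric.abs_horizontal_inner_le_mul_norm_fderiv (hax : IsAxisymmetric u)
    (hd : DifferentiableAt ℝ u x) :
    |x 0 * u x 0 + x 1 * u x 1| ≤ cylRadius x ^ 2 * ‖fderiv ℝ u x‖ := by
  have h1 : (x 0 * u x 0 + x 1 * u x 1) ^ 2 ≤ cylRadius x ^ 2 * (u x 0 ^ 2 + u x 1 ^ 2) := by
    rw [cylRadius_sq]
    nlinarith [sq_nonneg (x 0 * u x 1 - x 1 * u x 0)]
  have h2 : |x 0 * u x 0 + x 1 * u x 1| ≤ cylRadius x * Real.sqrt (u x 0 ^ 2 + u x 1 ^ 2) := by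
    have := Real.abs_le_sqrt h1
    rwa [Real.sqrt_mul (sq_nonneg _), Real.sqrt_sq (cylRadius_nonneg x)] at this
  calc |x 0 * u x 0 + x 1 * u x 1| ≤ cylRadius x * Real.sqrt (u x 0 ^ 2 + u x 1 ^ 2) := h2
    _ ≤ cylRadius x * (cylRadius x * ‖fderiv ℝ u x‖) :=
        mul_le_mul_of_nonneg_left (hax.sqrt_sq_add_sq_le_mul_norm_fderiv hd) (cylRadius_nonneg x)
    _ = cylRadius x ^ 2 * ‖fderiv ℝ u x‖ := by ring

/-- **`|u^θ/r| ≤ ‖Du‖` pointwise**: `|angVelQuot u x| ≤ ‖Du(x)‖` for an axisymmetric `u ∈ C²`,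
at every `x` (off the axis `r² · angVelQuot u = Γ`; across the axis by continuity). [folklore] -/
theorem IsAxisymmetric.abs_angVelQuot_le_norm_fderiv (hax : IsAxisymmetric u) (hu : ContDiff ℝ 2 u)
    (x : EuclideanSpace ℝ (Fin 3)) : |angVelQuot u x| ≤ ‖fderiv ℝ u x‖ := by
  have hud : Differentiable ℝ u := hu.differentiable two_ne_zero
  have hΦc : Continuous (angVelQuot u) :=
    (contDiff_angVelQuot (n := 0) (by exact_mod_cast hu)).continuous
  refine le_of_le_off_axis (continuous_abs.comp hΦc) (hu.continuous_fderiv two_ne_zero).norm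
    (fun z hz => ?_) x
  have hr2 : 0 < cylRadius z ^ 2 := by positivity
  have h := hax.abs_swirl_le_mul_norm_fderiv (hud z)
  rw [← hax.cylRadius_sq_mul_angVelQuot hu z, abs_mul, abs_of_pos hr2] at h
  exact le_of_mul_le_mul_left h hr2

/-- **`|uʳ/r| ≤ ‖Du‖` pointwise**: `|radVelQuot u x| ≤ ‖Du(x)‖` for an axisymmetric `u ∈ C²`.
[folklore] -/
theorem IsAxisymmetric.abs_radVelQuot_le_norm_fderiv (hax : IsAxisymmetric u) (hu : ContDiff ℝ 2 u)
    (x : EuclideanSpace ℝ (Fin 3)) : |radVelQuot u x| ≤ ‖fderiv ℝ u x‖ := by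
  have hud : Differentiable ℝ u := hu.differentiable two_ne_zero
  have hWc : Continuous (radVelQuot u) :=
    (contDiff_radVelQuot (n := 0) (by exact_mod_cast hu)).continuous
  refine le_of_le_off_axis (continuous_abs.comp hWc) (hu.continuous_fderiv two_ne_zero).norm
    (fun z hz => ?_) x
  have hr2 : 0 < cylRadius z ^ 2 := by positivity
  have h := hax.abs_horizontal_inner_le_mul_norm_fderiv (hud z)
  rw [← hax.cylRadius_sq_mul_radVelQuot hu z, abs_mul, abs_of_pos hr2] at h
  exact le_of_mul_le_mul_left h hr2

/-- `C^∞`-free smoothness of the curl: `u ∈ Cⁿ⁺¹ ⇒ FluidPDE.curl u ∈ Cⁿ`. [folklore] -/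
theorem contDiff_curl_of_succ {n : ℕ∞} (hu : ContDiff ℝ ((n : WithTop ℕ∞) + 1) u) :
    ContDiff ℝ n (FluidPDE.curl u) := by
  rw [curl_eq_curlCLM_comp]
  exact curlCLM.contDiff.comp (hu.fderiv_right (m := n) le_rfl)

/-- **`|ω^θ/r| ≤ ‖Dω‖` pointwise**: `|angVortQuot u x| ≤ ‖D(FluidPDE.curl u)(x)‖` for an axisymmetric
`u ∈ C³`. [folklore] -/
theorem IsAxisymmetric.abs_angVortQuot_le_norm_fderiv_curl (hax : IsAxisymmetric u)
    (hu : ContDiff ℝ 3 u) (x : EuclideanSpace ℝ (Fin 3)) :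
    |angVortQuot u x| ≤ ‖fderiv ℝ (FluidPDE.curl u) x‖ := by
  have hω2 : ContDiff ℝ 2 (FluidPDE.curl u) := contDiff_curl_of_succ (n := 2) (by exact_mod_cast hu)
  have haxω : IsAxisymmetric (FluidPDE.curl u) := hax.curl (hu.differentiable (by norm_num))
  exact haxω.abs_angVelQuot_le_norm_fderiv hω2 x

/-- **`|ωʳ/r| ≤ ‖Dω‖` pointwise**: `|radVelQuot (FluidPDE.curl u) x| ≤ ‖D(FluidPDE.curl u)(x)‖` for an axisymmetric
`u ∈ C³`. [folklore] -/
theorem IsAxisymmetric.abs_radVelQuot_curl_le_norm_fderiv_curl (hax : IsAxisymmetric u)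
    (hu : ContDiff ℝ 3 u) (x : EuclideanSpace ℝ (Fin 3)) :
    |radVelQuot (FluidPDE.curl u) x| ≤ ‖fderiv ℝ (FluidPDE.curl u) x‖ := by
  have hω2 : ContDiff ℝ 2 (FluidPDE.curl u) := contDiff_curl_of_succ (n := 2) (by exact_mod_cast hu)
  have haxω : IsAxisymmetric (FluidPDE.curl u) := hax.curl (hu.differentiable (by norm_num))
  exact haxω.abs_radVelQuot_le_norm_fderiv hω2 x

end Pointwise

/-! ### `∂_z` commutes with the quotients; `J = −∂_z(u^θ/r)` -/

section ZDeriv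

variable {u : EuclideanSpace ℝ (Fin 3) → EuclideanSpace ℝ (Fin 3)} {x : EuclideanSpace ℝ (Fin 3)}

/-- **The axial derivative of an axisymmetric field is axisymmetric**: `∂_z u (R_θ x) = R_θ ∂_z u (x)`
(the rotations fix `e_z`; `IsAxisymmetric.fderiv_rotZ`). [folklore] -/
theorem IsAxisymmetric.fderiv_apply_single_two (hax : IsAxisymmetric u) (hd : Differentiable ℝ u) :
    IsAxisymmetric fun y => fderiv ℝ u y (EuclideanSpace.single 2 1) := by
  intro θ y
  simp only
  rw [hax.fderiv_rotZ hd θ y]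
  simp only [ContinuousLinearMap.comp_apply, rotZL_apply, rotZ_apply_single_two]

/-- The axial derivative of `Γ` is the swirl of the axial derivative: `∂_zΓ = Γ(∂_z u)`
(`rotGen e_z = 0`). [folklore] -/
theorem fderiv_swirl_single_two (hd : DifferentiableAt ℝ u x) :
    fderiv ℝ (swirl u) x (EuclideanSpace.single 2 1) =
      swirl (fun y => fderiv ℝ u y (EuclideanSpace.single 2 1)) x := by
  rw [fderiv_swirl_apply hd, rotGen_single_two, inner_zero_left, add_zero, swirl_eq_inner_rotGen]

/-- **`∂_z(u^θ/r) = (∂_z u)^θ/r`**: the axial derivative commutes with the quotient `angVelQuot`,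
for an axisymmetric `u ∈ C³`, at every point. [folklore] -/
theorem IsAxisymmetric.fderiv_angVelQuot_single_two (hax : IsAxisymmetric u) (hu : ContDiff ℝ 3 u)
    (x : EuclideanSpace ℝ (Fin 3)) :
    fderiv ℝ (angVelQuot u) x (EuclideanSpace.single 2 1) =
      angVelQuot (fun y => fderiv ℝ u y (EuclideanSpace.single 2 1)) x := by
  have hu2 : ContDiff ℝ 2 u := hu.of_le (by norm_num)
  have hud : Differentiable ℝ u := hu.differentiable (by norm_num)
  have hΦ1 : ContDiff ℝ 1 (angVelQuot u) := contDiff_angVelQuot (n := 1) (by exact_mod_cast hu)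
  have hΦd : Differentiable ℝ (angVelQuot u) := hΦ1.differentiable one_ne_zero
  have huz : ContDiff ℝ 2 (fun y => fderiv ℝ u y (EuclideanSpace.single 2 1)) :=
    contDiff_fderiv_apply_const_succ (n := 2) (by exact_mod_cast hu) _
  have haxz : IsAxisymmetric (fun y => fderiv ℝ u y (EuclideanSpace.single 2 1)) :=
    hax.fderiv_apply_single_two hud
  have hL : Continuous fun y => fderiv ℝ (angVelQuot u) y (EuclideanSpace.single 2 1) :=
    (hΦ1.continuous_fderiv one_ne_zero).clm_apply continuous_const
  have hR : Continuous (angVelQuot fun y => fderiv ℝ u y (EuclideanSpace.single 2 1)) :=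
    (contDiff_angVelQuot (n := 0) (by exact_mod_cast huz)).continuous
  refine eq_of_eq_off_axis hL hR (fun z hz => ?_) x
  have hr2 : cylRadius z ^ 2 ≠ 0 := pow_ne_zero 2 hz
  apply mul_left_cancel₀ hr2
  -- `r² ∂_zΦ = ∂_z(r²Φ) = ∂_zΓ = Γ(∂_z u) = r² · angVelQuot (∂_z u)`
  rw [haxz.cylRadius_sq_mul_angVelQuot huz z, ← fderiv_swirl_single_two (hud z)]
  have hprod : swirl u = fun y => (y 0 ^ 2 + y 1 ^ 2) * angVelQuot u y := by
    funext y
    rw [← cylRadius_sq, hax.cylRadius_sq_mul_angVelQuot hu2 y]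
  have hρd : DifferentiableAt ℝ (fun y : EuclideanSpace ℝ (Fin 3) => y 0 ^ 2 + y 1 ^ 2) z :=
    contDiff_horizSq.differentiable two_ne_zero z
  rw [hprod, fderiv_fun_mul hρd (hΦd z)]
  simp only [_root_.add_apply, _root_.FunLike.coe_smul, Pi.smul_apply, smul_eq_mul,
    fderiv_rho_apply, cylRadius_sq]
  simp

/-- **`J = ωʳ/r = −∂_z(u^θ/r)`** (Lei–Zhang 2017, below (1.4): "`J = −∂_z v^θ/r`"; `ωʳ = −∂_z v^θ`):
`radVelQuot (FluidPDE.curl u) x = −∂_z (angVelQuot u) (x)` for an axisymmetric `u ∈ C³`, at every point.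
Off the axis `x₀ω₀ + x₁ω₁ = −(x₀∂₂u₁ − x₁∂₂u₀) + (Du[Jx])₂` and `(Du[Jx])₂ = (J u)₂ = 0`.
[cite: LeiZhang2017, §1 (below (1.4), arXiv p. 4)] -/
theorem IsAxisymmetric.radVelQuot_curl_eq_neg_fderiv_angVelQuot (hax : IsAxisymmetric u)
    (hu : ContDiff ℝ 3 u) (x : EuclideanSpace ℝ (Fin 3)) :
    radVelQuot (FluidPDE.curl u) x = -fderiv ℝ (angVelQuot u) x (EuclideanSpace.single 2 1) := by
  have hud : Differentiable ℝ u := hu.differentiable (by norm_num)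
  have hω2 : ContDiff ℝ 2 (FluidPDE.curl u) := contDiff_curl_of_succ (n := 2) (by exact_mod_cast hu)
  have haxω : IsAxisymmetric (FluidPDE.curl u) := hax.curl hud
  have huz : ContDiff ℝ 2 (fun y => fderiv ℝ u y (EuclideanSpace.single 2 1)) :=
    contDiff_fderiv_apply_const_succ (n := 2) (by exact_mod_cast hu) _
  have haxz : IsAxisymmetric (fun y => fderiv ℝ u y (EuclideanSpace.single 2 1)) :=
    hax.fderiv_apply_single_two hud
  rw [hax.fderiv_angVelQuot_single_two hu x]
  have hL : Continuous (radVelQuot (FluidPDE.curl u)) :=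
    (contDiff_radVelQuot (n := 0) (by exact_mod_cast hω2)).continuous
  have hR : Continuous fun y => -angVelQuot (fun y => fderiv ℝ u y (EuclideanSpace.single 2 1)) y :=
    (contDiff_angVelQuot (n := 0) (by exact_mod_cast huz)).continuous.neg
  refine eq_of_eq_off_axis hL hR (fun z hz => ?_) x
  have hr2 : cylRadius z ^ 2 ≠ 0 := pow_ne_zero 2 hz
  apply mul_left_cancel₀ hr2
  rw [haxω.cylRadius_sq_mul_radVelQuot hω2 z, mul_neg, haxz.cylRadius_sq_mul_angVelQuot huz z]
  -- the infinitesimal axisymmetry: `(Du[Jx])₂ = (J u)₂ = 0`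
  have hJ := congrArg (fun v : EuclideanSpace ℝ (Fin 3) => v 2) (hax.fderiv_rotGen (hud z))
  simp [rotGen_eq_sub_single] at hJ
  simp only [swirl, FluidPDE.curl]
  simp
  linear_combination hJ

end ZDeriv

/-! ### `L²` corollaries -/

section L2

variable {u : EuclideanSpace ℝ (Fin 3) → EuclideanSpace ℝ (Fin 3)}

/-- `u^θ/r ∈ L²` as soon as `Du ∈ L²` (axisymmetric `u ∈ C²`). [folklore] -/
theorem IsAxisymmetric.memLp_angVelQuot_of_memLp_fderiv (hax : IsAxisymmetric u)
    (hu : ContDiff ℝ 2 u) {p : ℝ≥0∞} (hD : MemLp (fderiv ℝ u) p volume) :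
    MemLp (angVelQuot u) p volume :=
  hD.of_le (contDiff_angVelQuot (n := 0) (by exact_mod_cast hu)).continuous.aestronglyMeasurable
    (Eventually.of_forall fun x => by
      rw [Real.norm_eq_abs]; exact hax.abs_angVelQuot_le_norm_fderiv hu x)

/-- `uʳ/r ∈ L²` as soon as `Du ∈ L²` (axisymmetric `u ∈ C²`). [folklore] -/
theorem IsAxisymmetric.memLp_radVelQuot_of_memLp_fderiv (hax : IsAxisymmetric u)
    (hu : ContDiff ℝ 2 u) {p : ℝ≥0∞} (hD : MemLp (fderiv ℝ u) p volume) :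
    MemLp (radVelQuot u) p volume :=
  hD.of_le (contDiff_radVelQuot (n := 0) (by exact_mod_cast hu)).continuous.aestronglyMeasurable
    (Eventually.of_forall fun x => by
      rw [Real.norm_eq_abs]; exact hax.abs_radVelQuot_le_norm_fderiv hu x)

/-- `ω^θ/r ∈ L²` as soon as `Dω ∈ L²` (axisymmetric `u ∈ C³`). [folklore] -/
theorem IsAxisymmetric.memLp_angVortQuot_of_memLp_fderiv_curl (hax : IsAxisymmetric u)
    (hu : ContDiff ℝ 3 u) {p : ℝ≥0∞} (hD : MemLp (fderiv ℝ (FluidPDE.curl u)) p volume) :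
    MemLp (angVortQuot u) p volume :=
  hD.of_le (contDiff_angVortQuot (n := 0) (by exact_mod_cast hu)).continuous.aestronglyMeasurable
    (Eventually.of_forall fun x => by
      rw [Real.norm_eq_abs]; exact hax.abs_angVortQuot_le_norm_fderiv_curl hu x)

/-- `ωʳ/r ∈ L²` as soon as `Dω ∈ L²` (axisymmetric `u ∈ C³`). [folklore] -/
theorem IsAxisymmetric.memLp_radVelQuot_curl_of_memLp_fderiv_curl (hax : IsAxisymmetric u)
    (hu : ContDiff ℝ 3 u) {p : ℝ≥0∞} (hD : MemLp (fderiv ℝ (FluidPDE.curl u)) p volume) :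
    MemLp (radVelQuot (FluidPDE.curl u)) p volume := by
  have hω2 : ContDiff ℝ 2 (FluidPDE.curl u) := contDiff_curl_of_succ (n := 2) (by exact_mod_cast hu)
  exact hD.of_le (contDiff_radVelQuot (n := 0) (by exact_mod_cast hω2)).continuous.aestronglyMeasurable
    (Eventually.of_forall fun x => by
      rw [Real.norm_eq_abs]; exact hax.abs_radVelQuot_curl_le_norm_fderiv_curl hu x)

end L2

end Literature.Analysis.FluidPDE
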